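import Summits.ABC.IUTFork.Repair.RHSlotReachMoverOddAssembly
import HarnessLib

/-!
# R-H ROUND 1 (D-0079, D-0107), row 8 «heightclass» — THE k2 STATEMENT OF RECORD IN KERNEL:
# `Repair.RHHeightClass.HBand X` ⟹ branch C's hull-level antecedent «`∃ ρ qK, QPinned ∧ PilotKummerCompatHull`» at `settingPrVolSharp`

PROOF-ONLY file (D-0012: 0 definitions, 0 `Prop` facts; abc-iut cell, rung LADDER-ABC:A2.RP → A2.RESCUE.H; seat abc-iut-rp-m2 gen 5 = R-H k2 DESK
hand #8 of `plan/rescue/R-H/RH-CANDIDATES.tsv` row 8, author abc-iut-lens-strengthen-1, typer abc-iut-rh-typ-8 (`Repair.RHHeightClass`, p459046),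
tester abc-iut-rh-tst-8). TAKES NO SIDE on [IUTchIII] Cor. 3.12 or on any author; `HBand` is a HYPOTHESIS (claim-tagged `def`), never asserted;
typed ≠ proved; instantiated ≠ endorsed; nothing here evaluates it on the table (k1: abc-iut-rh-num-1) or asserts it at any genuine datum.

`exists_qPinned_and_hull_settingPrVolSharp_of_hBand` — for ANY Dupuy–Hilado pilot datum `X`, the sharp print-normalised setting with Θ- and q-idele
coordinates of norms `p^{−j²·m_q(w)/e_w}` / `p^{−m_q(w)/e_w}` at the bad places (INTEGER Kummer orders `m_q(w) = P_q(w)`, as for realising ideles of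
genuine data: `2l ∣ ord_w(q_w)`, `PilotData.two_mul_l_dvd_ordq_of_jE_eq`; `‖t_Θ‖ = 1` off the bad places, `‖t_q‖ ≤ 1`), **`HBand X` implies
`∃ ρ qK, QPinned ∧ PilotKummerCompatHull`** (any columns) — the `hSHw` binder shape of the window certificates (`Conditional.abc_of_SH_v10K_window` ff.).
ASSEMBLY (everything BY NAME): the dictionary of `Repair.RHSlotReach.SlotReachWindow` is CONSTRUCTED from the candidate — `e = ramIdx`, `n₀ ≡ 1`,
on a fibre carrying a bad place `λ ≡ −r_p/e_p` with `e_p` the (uniform, by `HBand`) ramification and `r_p` the least certified value (`r♯` if the strict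
minimum exists, else `e_p`; `RHHeightClass.le_of_certVal_of_strictMin`, `RHHeightClassGlue.hrK_of_tie`), elsewhere `λ = −(⌊e/(p−1)⌋+1)/e`
(`RHHeightClassGlue.exists_mem_logUnits_rpow_le_div_succ`); the band cells give the window (`RHHeightClassGlue.slotCell_of_bandCell`,
`RHSlotReach.clause_iff_uniform`), the certificates give `hrad` (`RHHeightClassGlue.exists_mem_logUnits_rpow_le_of_certVal`), and
`RHSlotReachMoverOddAssembly.exists_qPinned_and_hull_settingPrVolSharp_of_slotReachWindow_one` (the mover lemma at `A = 1`, odd `p` under the bad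
places — `HBand` supplies `2 < p`) concludes. HONEST SCOPE: OUR typed sharp containers and Dupuy–Hilado's typed (Ind2); STRONGER-THAN-PRINT hull
reading (ADJUDICATION-SPEC §2 (G1′)); nothing about the printed GLOBAL inequality. [cite: DupuyHilado2025, §3.3, §3.9, §4.9]
[cite: WeilBNT1967, Ch. II §2, Th. 1] [cite: Mochizuki2012, IUTchIII Cor. 3.12 p. 173–174, Step (xi-f) p. 184; IUTchIV Prop. 1.2 (i) p. 10]
[claim: Mochizuki2012, status: disputed] for every IUT locution.
-/

noncomputable section

open Set Metric Function
open scoped Pointwise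

namespace Summit.ABC.IUTFork.Repair.RHHeightClassK2

section Setting

open NumberField IsDedekindDomain Literature.IUT.LogThetaLattice Literature.IUT.LogVolume Literature.NumberTheory.NumberFields
  Literature.NumberTheory.GaloisRepresentations.Ultrametric Summit.ABC.IUTFork.Thm311 Summit.ABC.IUTFork.Thm311.Real
  Summit.ABC.IUTFork.Cor312 Summit.ABC.IUTFork.Cor312.Setting Summit.ABC.IUTFork.Cor312Vol

variable {F : Type} [Field F] [NumberField F] (X : PilotData F) {logv : PadicLogs F} (hlog : LogvAnalytic logv)
  (M : Type) [Field M] [NumberField M]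
  (archPk : ∀ (j : (thetaIndex X).Label) (vQ : (thetaIndex X).VQ), Set ((logShellsDH X logv).Packet j vQ))
  (archSub : ∀ (j : (thetaIndex X).Label) (v : (thetaIndex X).V),
    Set ((logShellsDH X logv).Packet j ((thetaIndex X).over v)))
  (Ψ : ℤ → ∀ v : (thetaIndex X).V, v ∈ (thetaIndex X).Vbad → Set ((logShellsDH X logv).StarPacket v))
  (act : ℤ → ∀ v : (thetaIndex X).V, v ∈ (thetaIndex X).Vbad →
    (logShellsDH X logv).StarPacket v → Module.End ℚ ((logShellsDH X logv).StarPacket v))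
  (Mmod : ℤ → ∀ j : (thetaIndex X).LabelStar, Set ((logShellsDH X logv).GlobalPacket j.1))
  (region : ℤ → ∀ j : (thetaIndex X).LabelStar, FinDivisor M → ∀ vQ : (thetaIndex X).VQ,
    Set ((logShellsDH X logv).Packet j.1 vQ))
  (n : ℤ) {HT : Type} {LogLink : HT → HT → Type} {IsFull : ∀ {s t : HT}, LogLink s t → Prop}
  (lat : LGPGaussianLogThetaLattice LogLink IsFull)
  {Frd : Type} {IsoF : Frd → Frd → Type} {Ob : Frd → Type} {realify : Frd → Frd} {Strip : Type}
  {IsoS : Strip → Strip → Type} {Mv : ∀ v : (thetaIndex X).V, v ∈ (thetaIndex X).Vbad → Type}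
  [∀ v h, Monoid (Mv v h)]
  (sig : GlobalLGPFrobenioidSignature (thetaIndex X).lstar (thetaIndex X).V (· ∈ (thetaIndex X).Vbad)
    Frd IsoF Ob realify Strip IsoS Mv)
  (split : SplittingMonoids Mv) {ObΔ : Type} {N : ∀ v : (thetaIndex X).V, v ∈ (thetaIndex X).Vbad → Type}
  [∀ v h, Monoid (N v h)] (qData : QPilotData ObΔ N)
  (tq : ∀ (pp : Nat.Primes) (x : (thetaIndex X).Fibre (.inr pp)), haveI : Fact (pp : ℕ).Prime := ⟨pp.2⟩; kOf X pp.1 x)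
  (t : ∀ (pp : Nat.Primes) (_ : Fin X.lstar) (x : (thetaIndex X).Fibre (.inr pp)),
    haveI : Fact (pp : ℕ).Prime := ⟨pp.2⟩; kOf X pp.1 x)
  (htq0 : ∀ pp x, tq pp x ≠ 0)
  (htq1 : ∀ (pp : Nat.Primes) (x : (thetaIndex X).Fibre (.inr pp)),
    haveI : Fact (pp : ℕ).Prime := ⟨pp.2⟩; placeOf X pp.1 x ∉ X.S → ‖tq pp x‖ = 1)
  (col : ℤ → Column (logShellsDH X logv))

/-- **ROW 8 k2 IN KERNEL: `HBand X` ⟹ «`∃ ρ qK, QPinned ∧ PilotKummerCompatHull`» at `settingPrVolSharp`** (integer Kummer orders `m_q` realising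
`P_q` at the bad places, Θ-coordinates of norm `p^{−j²m_q/e}`, `‖t_Θ‖ = 1` off the bad places, `‖t_q‖ ≤ 1`; any columns `col`).
[claim: Mochizuki2012, status: disputed] for the candidate; the implication is the kernel-checked chain named in the module docstring. -/
theorem exists_qPinned_and_hull_settingPrVolSharp_of_hBand
    (htqle : ∀ pp x, ‖tq pp x‖ ≤ 1)
    (ht1 : ∀ (pp : Nat.Primes) (i : Fin X.lstar) (x : (thetaIndex X).Fibre (.inr pp)),
      haveI : Fact (pp : ℕ).Prime := ⟨pp.2⟩; placeOf X pp.1 x ∉ X.S → ‖t pp i x‖ = 1)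
    (mq : ∀ pp : Nat.Primes, (thetaIndex X).Fibre (.inr pp) → ℤ)
    (hmq : ∀ (pp : Nat.Primes) (w : (thetaIndex X).Fibre (.inr pp)), haveI : Fact (pp : ℕ).Prime := ⟨pp.2⟩
      placeOf X pp.1 w ∈ X.S → (mq pp w : ℝ) = X.qPilot (placeOf X pp.1 w))
    (hq : ∀ (pp : Nat.Primes) (w : (thetaIndex X).Fibre (.inr pp)), haveI : Fact (pp : ℕ).Prime := ⟨pp.2⟩
      placeOf X pp.1 w ∈ X.S → ‖tq pp w‖ = ((pp : ℕ) : ℝ) ^ (-(mq pp w : ℝ) / (ramIdx F (placeOf X pp.1 w) : ℝ)))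
    (hΘ : ∀ (pp : Nat.Primes) (i : Fin X.lstar) (w : (thetaIndex X).Fibre (.inr pp)), haveI : Fact (pp : ℕ).Prime := ⟨pp.2⟩
      placeOf X pp.1 w ∈ X.S → ‖t pp i w‖ =
        ((pp : ℕ) : ℝ) ^ (-((((((i : ℕ) : ℤ) + 1) ^ 2) * mq pp w : ℤ) : ℝ) / (ramIdx F (placeOf X pp.1 w) : ℝ)))
    (hH : RHHeightClass.HBand X) :
    ∃ (ρ' : (∀ v : (thetaIndex X).V, v ∈ (thetaIndex X).Vbad → Set ((logShellsDH X logv).StarPacket v)) →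
          ∀ (j : (thetaIndex X).Label) (vQ : (thetaIndex X).VQ), Set ((logShellsDH X logv).Packet j vQ))
        (qK : ∀ v : (thetaIndex X).V, v ∈ (thetaIndex X).Vbad → Set ((logShellsDH X logv).StarPacket v)),
        QPinned ({ toSituation := situationPrVol X hlog M archPk archSub Ψ act Mmod region, col := col } :
            LatticeSituation (thetaIndex X))
          (settingPrVolSharp X hlog M archPk archSub Ψ act Mmod region n lat sig split qData tq t htq0 htq1) ρ' qK ∧
        PilotKummerCompatHull ({ toSituation := situationPrVol X hlog M archPk archSub Ψ act Mmod region, col := col } :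
            LatticeSituation (thetaIndex X))
          (settingPrVolSharp X hlog M archPk archSub Ψ act Mmod region n lat sig split qData tq t htq0 htq1) ρ' qK := by
  classical
  haveI hne : ∀ pp : Nat.Primes, Fact (pp : ℕ).Prime := fun pp => ⟨pp.2⟩
  have i₀ : Fin X.lstar := ⟨0, by have := X.two_le_lstar; omega⟩
  -- bad fibres, their (uniform) ramification, the least certified exponent
  set Bad : Nat.Primes → Prop := fun pp => ∃ w : (thetaIndex X).Fibre (.inr pp), placeOf X pp.1 w ∈ X.S with hBad
  set eK : Nat.Primes → ℕ := fun pp => if h : Bad pp then ramIdx F (placeOf X pp.1 h.choose) else 1 with heK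
  set rK : Nat.Primes → ℤ := fun pp =>
    if h : ∃ r : ℤ, RHHeightClass.StrictMinPow (pp : ℕ) (eK pp) r then h.choose else (eK pp : ℤ) with hrK
  -- the dictionary
  set e : ∀ pp : Nat.Primes, (thetaIndex X).Fibre (.inr pp) → ℕ := fun pp x => ramIdx F (placeOf X pp.1 x) with he
  set n₀ : ∀ pp : Nat.Primes, (thetaIndex X).Fibre (.inr pp) → ℕ := fun _ _ => 1 with hn₀
  set lam : ∀ pp : Nat.Primes, (thetaIndex X).Fibre (.inr pp) → ℝ := fun pp x =>
    if Bad pp then -((rK pp : ℤ) : ℝ) / ((eK pp : ℕ) : ℝ)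
    else -(((ramIdx F (placeOf X pp.1 x) / ((pp : ℕ) - 1) + 1 : ℕ) : ℝ)) / (ramIdx F (placeOf X pp.1 x) : ℝ) with hlam
  set mΘ : ∀ pp : Nat.Primes, Fin (thetaIndex X).lstar → (thetaIndex X).Fibre (.inr pp) → ℤ :=
    fun pp i w => ((((i : ℕ) : ℤ) + 1) ^ 2) * mq pp w with hmΘ
  -- what `HBand` says on a bad fibre
  have hodd : ∀ (pp : Nat.Primes) (w : (thetaIndex X).Fibre (.inr pp)), placeOf X pp.1 w ∈ X.S → 2 < (pp : ℕ) :=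
    fun pp w hw => (hH pp i₀ w hw).1
  have hunif : ∀ (pp : Nat.Primes) (w : (thetaIndex X).Fibre (.inr pp)), placeOf X pp.1 w ∈ X.S →
      ∀ x : (thetaIndex X).Fibre (.inr pp), ramIdx F (placeOf X pp.1 x) = eK pp := by
    intro pp w hw x
    have hB : Bad pp := ⟨w, hw⟩
    have h1 := (hH pp i₀ w hw).2.1
    rw [heK]
    dsimp only
    rw [dif_pos hB, h1 x, h1 hB.choose]
  have heK1 : ∀ pp : Nat.Primes, 1 ≤ eK pp := by
    intro pp
    rw [heK]
    dsimp only
    split_ifs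
    · exact Nat.one_le_iff_ne_zero.2 (ramIdx_ne_zero F _)
    · exact le_rfl
  have hcert : ∀ pp : Nat.Primes, RHHeightClass.CertVal (pp : ℕ) (eK pp) (rK pp) := by
    intro pp
    rw [hrK]
    dsimp only
    split_ifs with h
    · exact Or.inl h.choose_spec
    · exact Or.inr rfl
  have hrKle : ∀ (pp : Nat.Primes) (r : ℤ), RHHeightClass.CertVal (pp : ℕ) (eK pp) r → rK pp ≤ r := by
    intro pp r hr
    rw [hrK]
    dsimp only
    split_ifs with h
    · exact RHHeightClass.le_of_certVal_of_strictMin (heK1 pp) h.choose_spec hr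
    · exact RHHeightClassGlue.hrK_of_tie (fun r' hr' => h ⟨r', hr'⟩) r hr
  -- the certificates `hrad` at every place
  have hrad : ∀ (pp : Nat.Primes) (x : (thetaIndex X).Fibre (.inr pp)),
      ∃ z ∈ (logUnits (kOf X pp.1 x) : Set (kOf X pp.1 x)), ((pp : ℕ) : ℝ) ^ (lam pp x) ≤ ‖z‖ := by
    intro pp x
    rw [hlam]
    dsimp only
    by_cases hB : Bad pp
    · rw [if_pos hB]
      have hw := hB.choose_spec
      have hc : RHHeightClass.CertVal (pp : ℕ) (ramIdx F (placeOf X pp.1 x)) (rK pp) := by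
        rw [hunif pp _ hw x]; exact hcert pp
      have h := RHHeightClassGlue.exists_mem_logUnits_rpow_le_of_certVal X pp.1 (hodd pp _ hw) x hc
      rw [hunif pp _ hw x] at h
      exact h
    · rw [if_neg hB]
      exact RHHeightClassGlue.exists_mem_logUnits_rpow_le_div_succ X pp.1 x
  -- the window from the band cells
  have hW : RHSlotReach.SlotReachWindow (thetaIndex X).lstar (fun pp => (thetaIndex X).Fibre (.inr pp))
      (fun pp w => placeOf X pp.1 w ∈ X.S) e n₀ lam mΘ mq := by
    intro pp i w hw x
    have hB : Bad pp := ⟨w, hw⟩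
    obtain ⟨-, -, r, hcr, hcell⟩ := hH pp i w hw
    rw [he, hn₀, hlam, hmΘ]
    dsimp only
    simp only [if_pos hB, hunif pp w hw]
    rw [RHSlotReach.clause_iff_uniform (eK pp) (heK1 pp) 1 (rK pp) (i : ℕ) _ (mq pp w)]
    refine RHHeightClassGlue.slotCell_of_bandCell (heK1 pp) le_rfl (i : ℕ) ?_
    rw [hunif pp w hw w] at hcr hcell
    have hle : ((rK pp : ℤ) : ℝ) ≤ (r : ℝ) := by exact_mod_cast hrKle pp r hcr
    have hc : (0 : ℝ) ≤ ((i : ℕ) : ℝ) + 1 := by positivity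
    have hcell' := RHHeightClass.bandCell_of_le hc hle hcell
    rw [← hmq pp w hw] at hcell'
    exact_mod_cast hcell'
  exact RHSlotReachMoverOddAssembly.exists_qPinned_and_hull_settingPrVolSharp_of_slotReachWindow_one X hlog M archPk archSub Ψ act Mmod
    region n lat sig split qData tq t htq0 htq1 col e n₀ lam mΘ mq hodd htqle (fun _ _ => rfl) (fun _ _ => rfl) hrad ht1
    (fun pp i w hw => hΘ pp i w hw) hq hW

end Setting

end Summit.ABC.IUTFork.Repair.RHHeightClassK2

end
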